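import Mathlib
import Literature.Probability.LatticeModels.TemperleyLiebBaxterization
import Literature.Probability.Percolation.DiagonalColumnPatterns
import Literature.Probability.Percolation.DiagonalStripTransferInhomogeneous
import Literature.Probability.Percolation.DiagonalStripTLAction
import Literature.Probability.Percolation.DiagonalStripTransferInterlacingTwoRow
import Literature.Probability.Percolation.DiagonalStripLumping
import HarnessLib

/-!
# Generic rapidities: Lemma 3.2 without genericity hypotheses

Topic `Literature/Probability/Percolation`. The interlacing relations of Ikhlef–Ponsaing's transfer
matrix (`DiagonalStripTransferInterlacingTwoRow.lean`) hold pointwise under nonvanishing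
hypotheses on the brackets `[qw/z_k]`, `[qwz_k]`. Over the field of rational functions in the
rapidities these hypotheses hold identically, which is the setting in which Laurent-polynomial
solutions of the qKZ system live (IP12 §3.4–3.5). This file sets up that field
(`RapidityField K₀ = Frac K₀[X_0, X_1, …]`, `w = X 0`, `z_k = X k`, `genC q` the constant `q`),
proves the nonvanishing of the brackets by evaluation (`qbr_genW_div_genZ_ne_zero`,
`qbr_genW_mul_genZ_ne_zero`), and restates Lemma 3.2 hypothesis-free:
**`ipTransferMatrixW_interlace_odd_generic`**, **`ipTransferMatrixW_interlace_even_generic`**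
(only `q² + q + 1 = 0` in the base field `K₀` and validity of the input pattern remain).

## References

* Y. Ikhlef, A. K. Ponsaing, J. Stat. Phys. 149 (2012) 10–36, arXiv:1202.5476, Lemma 3.2, §3.4.
  [IkhlefPonsaing2012]
-/


namespace Literature.Probability.Percolation

open MvPolynomial

section Generic

variable (K₀ : Type*) [Field K₀]

/-- The field of rational functions in the rapidities (`X 0 = w`, `X k = z_k`). [folklore] -/
abbrev RapidityField : Type _ := FractionRing (MvPolynomial ℕ K₀)

/-- The embedding of the polynomial ring. [folklore] -/
noncomputable abbrev toRF : MvPolynomial ℕ K₀ →+* RapidityField K₀ :=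
  algebraMap (MvPolynomial ℕ K₀) (RapidityField K₀)

/-- The generic horizontal rapidity `w = X 0`. [folklore] -/
noncomputable def genW : RapidityField K₀ := toRF K₀ (X 0)

/-- The generic vertical rapidities `z_k = X k`. [folklore] -/
noncomputable def genZ : ℕ → RapidityField K₀ := fun k => toRF K₀ (X k)

/-- A scalar as a constant rational function. [folklore] -/
noncomputable def genC (q : K₀) : RapidityField K₀ := toRF K₀ (C q)

variable {K₀}

/-- The polynomial ring embeds in the rapidity field. [folklore] -/
theorem toRF_injective : Function.Injective (toRF K₀) :=
  IsFractionRing.injective (MvPolynomial ℕ K₀) (RapidityField K₀)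

/-- A polynomial with a nonvanishing evaluation is nonzero in the rapidity field. [folklore] -/
theorem toRF_ne_zero_of_eval {P : MvPolynomial ℕ K₀} (x : ℕ → K₀) (h : eval x P ≠ 0) : toRF K₀ P ≠ 0 := by
  intro hP
  have : P = 0 := toRF_injective (by rw [hP, map_zero])
  exact h (by rw [this, map_zero])

/-- Two polynomials with different evaluations somewhere differ in the rapidity field. [folklore] -/
theorem toRF_ne_of_eval {P Q : MvPolynomial ℕ K₀} (x : ℕ → K₀) (h : eval x P ≠ eval x Q) : toRF K₀ P ≠ toRF K₀ Q := by
  intro hPQ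
  exact h (by rw [toRF_injective hPQ])

/-- The generic rapidities are nonzero. [folklore] -/
theorem genZ_ne_zero (k : ℕ) : genZ K₀ k ≠ 0 :=
  toRF_ne_zero_of_eval (fun _ => 1) (by simp)

/-- The generic horizontal rapidity is nonzero. [folklore] -/
theorem genW_ne_zero : genW K₀ ≠ 0 :=
  toRF_ne_zero_of_eval (fun _ => 1) (by simp)

/-- `[x] = x - x⁻¹` vanishes only if `x² = 1` (for `x ≠ 0`). [folklore] -/
theorem qbr_ne_zero_of_sq_ne_one {F : Type*} [Field F] {x : F} (hx : x ≠ 0) (h : x ^ 2 ≠ 1) :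
    Literature.Probability.LatticeModels.TemperleyLieb.qbr x ≠ 0 := by
  unfold Literature.Probability.LatticeModels.TemperleyLieb.qbr
  intro h0
  apply h
  have : x * x - x * x⁻¹ = 0 := by rw [← mul_sub, h0, mul_zero]
  rw [mul_inv_cancel₀ hx] at this
  linear_combination this

/-- **`[q w / z_k] ≠ 0` generically** (`k ≥ 1`, `q ≠ 0`). [folklore] -/
theorem qbr_genW_div_genZ_ne_zero {q : K₀} (hq : q ≠ 0) {k : ℕ} (hk : k ≠ 0) :
    Literature.Probability.LatticeModels.TemperleyLieb.qbr (genC K₀ q * genW K₀ / genZ K₀ k) ≠ 0 := by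
  refine qbr_ne_zero_of_sq_ne_one (div_ne_zero (mul_ne_zero ?_ genW_ne_zero) (genZ_ne_zero k)) ?_
  · exact toRF_ne_zero_of_eval (fun _ => 1) (by simp [hq])
  · rw [div_pow, Ne, div_eq_one_iff_eq (pow_ne_zero _ (genZ_ne_zero k))]
    unfold genC genW genZ
    rw [← map_mul, ← map_pow, ← map_pow]
    refine toRF_ne_of_eval (fun n => if n = 0 then 1 else 0) ?_
    simp [hk, hq]

/-- **`[q w z_k] ≠ 0` generically.** [folklore] -/
theorem qbr_genW_mul_genZ_ne_zero {q : K₀} (hq : q ≠ 0) (k : ℕ) :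
    Literature.Probability.LatticeModels.TemperleyLieb.qbr (genC K₀ q * genW K₀ * genZ K₀ k) ≠ 0 := by
  refine qbr_ne_zero_of_sq_ne_one (mul_ne_zero (mul_ne_zero ?_ genW_ne_zero) (genZ_ne_zero k)) ?_
  · exact toRF_ne_zero_of_eval (fun _ => 1) (by simp [hq])
  · unfold genC genW genZ
    rw [← map_mul, ← map_mul, ← map_pow, Ne, ← (toRF K₀).map_one]
    refine toRF_ne_of_eval (fun _ => 0) ?_
    simp

/-- The quadratic relation passes to the rapidity field. [folklore] -/
theorem genC_quad {q : K₀} (hq : q ^ 2 + q + 1 = 0) : genC K₀ q ^ 2 + genC K₀ q + 1 = 0 := by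
  unfold genC
  rw [← map_pow, ← map_one (toRF K₀), ← map_add, ← map_add, ← C_pow, ← C_1, ← C_add, ← C_add, hq, C_0, map_zero]

/-- A root of `q² + q + 1` is nonzero. [folklore] -/
theorem ne_zero_of_quad {F : Type*} [Field F] {q : F} (hq : q ^ 2 + q + 1 = 0) : q ≠ 0 := by
  rintro rfl; norm_num at hq

end Generic

/-! ### Lemma 3.2 and the propagation over the rapidity field (no genericity hypotheses) -/

section GenericLemma32

variable {K₀ : Type*} [Field K₀] {m : ℕ}

open Literature.Probability.LatticeModels.TemperleyLieb

/-- **Lemma 3.2 (interlacing, odd level) for generic rapidities.** [cite: IkhlefPonsaing2012, Lemma 3.2] -/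
theorem ipTransferMatrixW_interlace_odd_generic {q : K₀} (hq : q ^ 2 + q + 1 = 0) (j j1 : Fin (m + 1))
    (hj1 : (j1 : ℕ) = j + 1) {Q : ColPattern m} (hQ : IsValid 0 Q) (Q'' : ColPattern m) :
    qbr (genC K₀ q * genZ K₀ (2 * j + 2) / genZ K₀ (2 * j + 1)) * ipTransferMatrixW m (genC K₀ q) (genW K₀) (genZ K₀) Q Q'' -
        qbr (genZ K₀ (2 * j + 1) / genZ K₀ (2 * j + 2)) *
          ∑ Q' ∈ Finset.univ.filter (fun Q' => lump (cpJoin j j1 Q') = Q''),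
            ipTransferMatrixW m (genC K₀ q) (genW K₀) (genZ K₀) Q Q' =
      qbr (genC K₀ q * genZ K₀ (2 * j + 2) / genZ K₀ (2 * j + 1)) *
          ipTransferMatrixW m (genC K₀ q) (genW K₀) (zswap (genZ K₀) (2 * j + 1)) Q Q'' -
        qbr (genZ K₀ (2 * j + 1) / genZ K₀ (2 * j + 2)) *
          ipTransferMatrixW m (genC K₀ q) (genW K₀) (zswap (genZ K₀) (2 * j + 1)) (cpJoin j j1 Q) Q'' :=
  have hq0 := ne_zero_of_quad hq
  ipTransferMatrixW_interlace_odd (genC_quad hq) genW_ne_zero (genZ K₀) j j1 hj1 (genZ_ne_zero _) (genZ_ne_zero _)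
    (qbr_genW_div_genZ_ne_zero hq0 (by omega)) (qbr_genW_div_genZ_ne_zero hq0 (by omega))
    (qbr_genW_mul_genZ_ne_zero hq0 _) (qbr_genW_mul_genZ_ne_zero hq0 _) hQ Q''

/-- **Lemma 3.2 (interlacing, even level) for generic rapidities.** [cite: IkhlefPonsaing2012, Lemma 3.2] -/
theorem ipTransferMatrixW_interlace_even_generic {q : K₀} (hq : q ^ 2 + q + 1 = 0) (b0 b : Fin (m + 1))
    (hb0 : (b : ℕ) = b0 + 1) {Q : ColPattern m} (hQ : IsValid 0 Q) (Q'' : ColPattern m) :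
    qbr (genC K₀ q * genZ K₀ (2 * b + 1) / genZ K₀ (2 * b)) * ipTransferMatrixW m (genC K₀ q) (genW K₀) (genZ K₀) Q Q'' -
        qbr (genZ K₀ (2 * b) / genZ K₀ (2 * b + 1)) *
          ∑ Q' ∈ Finset.univ.filter (fun Q' => lump (cpIsolate b Q') = Q''),
            ipTransferMatrixW m (genC K₀ q) (genW K₀) (genZ K₀) Q Q' =
      qbr (genC K₀ q * genZ K₀ (2 * b + 1) / genZ K₀ (2 * b)) *
          ipTransferMatrixW m (genC K₀ q) (genW K₀) (zswap (genZ K₀) (2 * b)) Q Q'' -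
        qbr (genZ K₀ (2 * b) / genZ K₀ (2 * b + 1)) *
          ipTransferMatrixW m (genC K₀ q) (genW K₀) (zswap (genZ K₀) (2 * b)) (cpIsolate b Q) Q'' :=
  have hq0 := ne_zero_of_quad hq
  ipTransferMatrixW_interlace_even (genC_quad hq) genW_ne_zero (genZ K₀) b0 b hb0 (genZ_ne_zero _) (genZ_ne_zero _)
    (qbr_genW_div_genZ_ne_zero hq0 (by omega)) (qbr_genW_div_genZ_ne_zero hq0 (by omega))
    (qbr_genW_mul_genZ_ne_zero hq0 _) (qbr_genW_mul_genZ_ne_zero hq0 _) hQ Q''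

end GenericLemma32

end Literature.Probability.Percolation
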